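import Mathlib
import HarnessLib
import Summits.HubbardSuperconductivity.HubbardSuperconductivity.Theorems.KLProgrammeC4aLatticeTubeAlias
import Summits.HubbardSuperconductivity.HubbardSuperconductivity.Theorems.KLProgrammeC4aMomentumKernelTrigPoly

/-!
# Route `KLProgramme` — crux C4a, LAYER 2 of the tadpole representation: the lattice Fourier transform of the slice weight at a lattice position
# `y` is `(2π)⁻²·∫_{tube} f(e_K q)·e^{iq·ỹ} dq` up to the aliasing tail (one position at a time)

Cell `gate-hubbard-kl`, lane hubbard-kl-c4a-1 (g3); helper for stub (C) `stub_twoLeg_curvature` of the engine-flow child `KLRegimeEngineV17F2`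
(stmt-HubbardSuperconductivity-20437); memo HOME/hubbard-kl-c4a-1/C4A-PLAN.md §16.4 step (4).  After `…C4aMomentumKernelTrigPoly.sum_slice_mul_vertexFn_tadpoleLegs_eq`
the loop momentum of LAYER 1's tadpole reading enters ONLY through `S_{p₀}(y) = Σ_{q⃗ ∈ ℤ_L²} s(p₀, q⃗)·χ_{q⃗}(y)`, the lattice Fourier transform of the slice
weight `s(p₀, q⃗) = f(e_K(p_q⃗))` (`f = ŝ_{n+1}(ω_{p₀}, ·)`, a smooth profile of the LEVEL supported in `(−r, r)`).  By `torusChar_eq_cexp_valMinAbs` the character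
is the plane wave `e^{i p_q⃗·ỹ}` with the CENTRED integer frequency `ỹ` (`2|ỹ_i| ≤ L`), so `S_{p₀}(y)` is a lattice tube sum with the one-term trigonometric
polynomial `V(q) = e^{iq·ỹ}` and `…C4aLatticeTubeAlias.norm_latticeTubeAvg_sub_tubeIntegral_le_of_trigPoly'` applies:

* **`norm_sliceTransform_sub_tubeFourier_le`** — `‖L⁻²·S_{p₀}(y) − (2π)⁻²·∫_{tube} f(e_K q)·e^{iq·ỹ} dq‖ ≤ D/(2π)^M·(2/L)^{M−4}·4C₂` whenever
  `‖D^M (y ↦ f(e_K(2πy)))‖ ≤ D`, `M ≥ 4` — uniformly in the position `y` (the coefficient `Σ‖c‖ = 1`).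

Summed against the coefficients `C(y)` of `kernel_four_loop_eq_sum_torusChar` (`Σ_y ‖C(y)‖ ≤ |Λ|^{-4}Σ_x‖W₄(x)‖`) this is the aliasing term of the representation;
the main terms recombine under the integral into `(2π)⁻²∫_{tube} f(e_K q)·V(q) dq`, `V(q) = Σ_y C(y)e^{iq·ỹ}` — the tube tadpole of …C4aTubeTadpoleCert.
Pure composition; nothing is asserted about the Hubbard model.  References: BGM 2006 §2.1 (2.3)–(2.5) [cite: BenfattoGiulianiMastropietro2006]; Boyd 2001 §4.5 Thm 20
[cite: Boyd2001].
-/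

noncomputable section

namespace Summit.HubbardSuperconductivity.HubbardSuperconductivity.Theorems.C4a

set_option linter.dupNamespace false -- summit = problem name (single-conjunct summit), D-0017

open Real Set MeasureTheory
open Literature.Probability.LatticeModels Literature.MathematicalPhysics.QuantumLattice
open Summit.HubbardSuperconductivity.HubbardSuperconductivity.Theorems.DispersionFlow

/-- The character at the lattice momentum as the one-term trigonometric polynomial of `…C4aLatticeTubeAlias` with the centred frequency `ỹ`. -/
theorem torusChar_eq_trigPolyV_latticeMomentum {L : ℕ} [NeZero L] (q y : TorusSite 2 L) :
    torusChar q y = ∑ x ∈ ({fun i => (y i).valMinAbs} : Finset (Fin 2 → ℤ)), (1 : ℂ) *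
      Complex.exp (((∑ i, (x i : ℝ) * (WithLp.toLp 2 (latticeMomentum L q) : Momentum) i : ℝ) : ℂ) * Complex.I) := by
  rw [Finset.sum_singleton, one_mul, torusChar_eq_cexp_valMinAbs]
  congr 3
  refine Finset.sum_congr rfl fun i _ => ?_
  rw [PiLp.toLp_apply, mul_comm]

/-- **THE SLICE TRANSFORM AT A POSITION is the tube Fourier integral up to aliasing**: for a smooth slice profile `f` with `tsupport f ⊆ (−r, r)` and
`‖D^M (y ↦ f(e_K(2πy)))‖ ≤ D` (`M ≥ 4`), at every lattice position `y`:
`‖L⁻²·Σ_{q⃗} f(e_K(p_q⃗))·χ_{q⃗}(y) − (2π)⁻²·∫_{tube} f(e_K q)·e^{i Σ_i ỹ_i q_i} dq‖ ≤ D/(2π)^M·(2/L)^{M−4}·(4·Σ_{k∈ℤ²}∏_j(1+k_j²)⁻¹)`.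
[cite: Boyd2001, §4.5 Theorem 20 (4.47)] -/
theorem norm_sliceTransform_sub_tubeFourier_le {L : ℕ} [NeZero L] (μ : ℝ) (K : TrigPolyC4v) {r : ℝ} {f : ℝ → ℂ}
    (hf : ContDiff ℝ (⊤ : ℕ∞) f) (hfsupp : tsupport f ⊆ Ioo (-r) r) {M : ℕ} (hM : 4 ≤ M) {D : ℝ}
    (hD : ∀ y : Momentum, ‖iteratedFDeriv ℝ M (fun y : Momentum => f (frameLevel μ K ((2 * π) • y))) y‖ ≤ D) (y : TorusSite 2 L) :
    ‖((L : ℂ) ^ 2)⁻¹ * ∑ q : TorusSite 2 L, f (frameLevel μ K (WithLp.toLp 2 (latticeMomentum L q))) * torusChar q y -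
        ((2 * π) ^ 2)⁻¹ • ∫ p in {q : ℝ × ℝ | |q.1| < π ∧ |q.2| < π ∧ |frameLevel μ K (WithLp.toLp 2 ![q.1, q.2])| < r},
          f (frameLevel μ K (WithLp.toLp 2 ![p.1, p.2])) *
            Complex.exp (((∑ i, ((y i).valMinAbs : ℝ) * (WithLp.toLp 2 ![p.1, p.2] : Momentum) i : ℝ) : ℂ) * Complex.I)‖ ≤
      D / (2 * Real.pi) ^ M * (2 / (L : ℝ)) ^ (M - 4) * (4 * ∑' k : Fin 2 → ℤ, ∏ j, (1 + (k j : ℝ) ^ 2)⁻¹) := by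
  have hB : ∀ x ∈ ({fun i => (y i).valMinAbs} : Finset (Fin 2 → ℤ)), ∀ i, 2 * |x i| ≤ (L : ℤ) := by
    intro x hx i
    rw [Finset.mem_singleton] at hx
    subst hx
    exact two_mul_abs_valMinAbs_le y i
  have h := norm_latticeTubeAvg_sub_tubeIntegral_le_of_trigPoly' (L := L) μ K hf hfsupp ({fun i => (y i).valMinAbs} : Finset (Fin 2 → ℤ))
    (fun _ => (1 : ℂ)) hB hM hD
  simp only [Finset.sum_singleton, one_mul, norm_one] at h
  simp only [torusChar_eq_trigPolyV_latticeMomentum, Finset.sum_singleton, one_mul]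
  exact h


/-! ## §2 Recombination against a coefficient family: `Σ_y C(y)·L⁻²S(y)` is the tube tadpole of `V(q) = Σ_y C(y)e^{iq·ỹ}` up to `(Σ‖C‖)·tail` -/

/-- The tube integrand `f(e_K q)·e^{iq·ỹ}` is integrable on the tube (continuous on the closed square, the tube is a measurable subset). -/
theorem integrableOn_tube_levelPlaneWave (μ : ℝ) (K : TrigPolyC4v) (r : ℝ) {f : ℝ → ℂ} (hf : Continuous f) (x : Fin 2 → ℤ) :
    IntegrableOn (fun p : ℝ × ℝ => f (frameLevel μ K (WithLp.toLp 2 ![p.1, p.2])) *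
        Complex.exp (((∑ i, (x i : ℝ) * (WithLp.toLp 2 ![p.1, p.2] : Momentum) i : ℝ) : ℂ) * Complex.I))
      {q : ℝ × ℝ | |q.1| < π ∧ |q.2| < π ∧ |frameLevel μ K (WithLp.toLp 2 ![q.1, q.2])| < r} := by
  have hcoord : Continuous fun p : ℝ × ℝ => (WithLp.toLp 2 ![p.1, p.2] : Momentum) := by
    refine (PiLp.continuous_toLp 2 _).comp ?_
    refine continuous_pi fun i => ?_
    fin_cases i
    · exact continuous_fst
    · exact continuous_snd
  have hcont : Continuous fun p : ℝ × ℝ => f (frameLevel μ K (WithLp.toLp 2 ![p.1, p.2])) *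
      Complex.exp (((∑ i, (x i : ℝ) * (WithLp.toLp 2 ![p.1, p.2] : Momentum) i : ℝ) : ℂ) * Complex.I) := by
    refine (hf.comp ((EngineV8.contDiff_frameLevel μ K (n := 0)).continuous.comp hcoord)).mul ?_
    refine Complex.continuous_exp.comp (Continuous.mul ?_ continuous_const)
    refine Complex.continuous_ofReal.comp (continuous_finsetSum _ fun i _ => continuous_const.mul ?_)
    exact (PiLp.continuous_apply 2 _ i).comp hcoord
  refine (hcont.continuousOn.integrableOn_compact (isCompact_Icc.prod isCompact_Icc :
    IsCompact (Icc (-π) π ×ˢ Icc (-π) π : Set (ℝ × ℝ)))).mono_set ?_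
  rintro q ⟨h1, h2, -⟩
  exact ⟨⟨(abs_lt.1 h1).1.le, (abs_lt.1 h1).2.le⟩, ⟨(abs_lt.1 h2).1.le, (abs_lt.1 h2).2.le⟩⟩

/-- **RECOMBINATION.**  For any coefficient family `C` on the lattice positions: the weighted sum of the slice transforms is the tube tadpole of the trigonometric
polynomial `V(q) = Σ_y C(y)·e^{iq·ỹ}` up to `(Σ_y ‖C(y)‖)·(tail)`:
`‖Σ_y C(y)·L⁻²S(y) − (2π)⁻²·∫_{tube} f(e_K q)·Σ_y C(y)e^{iq·ỹ} dq‖ ≤ (Σ_y‖C(y)‖)·D/(2π)^M·(2/L)^{M−4}·4C₂`. [cite: Boyd2001, §4.5 Theorem 20 (4.47)] -/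
theorem norm_sum_coeff_mul_sliceTransform_sub_tubeIntegral_le {L : ℕ} [NeZero L] (μ : ℝ) (K : TrigPolyC4v) {r : ℝ} {f : ℝ → ℂ}
    (hf : ContDiff ℝ (⊤ : ℕ∞) f) (hfsupp : tsupport f ⊆ Ioo (-r) r) {M : ℕ} (hM : 4 ≤ M) {D : ℝ}
    (hD : ∀ y : Momentum, ‖iteratedFDeriv ℝ M (fun y : Momentum => f (frameLevel μ K ((2 * π) • y))) y‖ ≤ D) (C : TorusSite 2 L → ℂ) :
    ‖∑ y : TorusSite 2 L, C y * (((L : ℂ) ^ 2)⁻¹ * ∑ q : TorusSite 2 L, f (frameLevel μ K (WithLp.toLp 2 (latticeMomentum L q))) * torusChar q y) -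
        ((2 * π) ^ 2)⁻¹ • ∫ p in {q : ℝ × ℝ | |q.1| < π ∧ |q.2| < π ∧ |frameLevel μ K (WithLp.toLp 2 ![q.1, q.2])| < r},
          f (frameLevel μ K (WithLp.toLp 2 ![p.1, p.2])) *
            ∑ y : TorusSite 2 L, C y * Complex.exp (((∑ i, ((y i).valMinAbs : ℝ) * (WithLp.toLp 2 ![p.1, p.2] : Momentum) i : ℝ) : ℂ) * Complex.I)‖ ≤
      (∑ y : TorusSite 2 L, ‖C y‖) * (D / (2 * Real.pi) ^ M * (2 / (L : ℝ)) ^ (M - 4) * (4 * ∑' k : Fin 2 → ℤ, ∏ j, (1 + (k j : ℝ) ^ 2)⁻¹)) := by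
  set tube : Set (ℝ × ℝ) := {q : ℝ × ℝ | |q.1| < π ∧ |q.2| < π ∧ |frameLevel μ K (WithLp.toLp 2 ![q.1, q.2])| < r} with htube
  set T : ℝ := D / (2 * Real.pi) ^ M * (2 / (L : ℝ)) ^ (M - 4) * (4 * ∑' k : Fin 2 → ℤ, ∏ j, (1 + (k j : ℝ) ^ 2)⁻¹) with hT
  -- the integral of the finite sum is the finite sum of the integrals
  have hint : ∀ y : TorusSite 2 L, IntegrableOn (fun p : ℝ × ℝ => f (frameLevel μ K (WithLp.toLp 2 ![p.1, p.2])) *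
      Complex.exp (((∑ i, ((y i).valMinAbs : ℝ) * (WithLp.toLp 2 ![p.1, p.2] : Momentum) i : ℝ) : ℂ) * Complex.I)) tube :=
    fun y => integrableOn_tube_levelPlaneWave μ K r hf.continuous (fun i => (y i).valMinAbs)
  have hswap : ∫ p in tube, f (frameLevel μ K (WithLp.toLp 2 ![p.1, p.2])) *
        ∑ y : TorusSite 2 L, C y * Complex.exp (((∑ i, ((y i).valMinAbs : ℝ) * (WithLp.toLp 2 ![p.1, p.2] : Momentum) i : ℝ) : ℂ) * Complex.I) =
      ∑ y : TorusSite 2 L, C y * ∫ p in tube, f (frameLevel μ K (WithLp.toLp 2 ![p.1, p.2])) *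
        Complex.exp (((∑ i, ((y i).valMinAbs : ℝ) * (WithLp.toLp 2 ![p.1, p.2] : Momentum) i : ℝ) : ℂ) * Complex.I) := by
    have hre : ∀ p : ℝ × ℝ, f (frameLevel μ K (WithLp.toLp 2 ![p.1, p.2])) *
        ∑ y : TorusSite 2 L, C y * Complex.exp (((∑ i, ((y i).valMinAbs : ℝ) * (WithLp.toLp 2 ![p.1, p.2] : Momentum) i : ℝ) : ℂ) * Complex.I) =
        ∑ y : TorusSite 2 L, C y * (f (frameLevel μ K (WithLp.toLp 2 ![p.1, p.2])) *
          Complex.exp (((∑ i, ((y i).valMinAbs : ℝ) * (WithLp.toLp 2 ![p.1, p.2] : Momentum) i : ℝ) : ℂ) * Complex.I)) := by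
      intro p
      rw [Finset.mul_sum]
      exact Finset.sum_congr rfl fun y _ => by ring
    simp_rw [hre]
    rw [integral_finsetSum _ fun y _ => (hint y).const_mul (C y)]
    exact Finset.sum_congr rfl fun y _ => integral_const_mul _ _
  rw [hswap, Finset.smul_sum, ← Finset.sum_sub_distrib]
  have hy : ∀ y : TorusSite 2 L,
      ‖C y * (((L : ℂ) ^ 2)⁻¹ * ∑ q : TorusSite 2 L, f (frameLevel μ K (WithLp.toLp 2 (latticeMomentum L q))) * torusChar q y) -
          ((2 * π) ^ 2)⁻¹ • (C y * ∫ p in tube, f (frameLevel μ K (WithLp.toLp 2 ![p.1, p.2])) *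
            Complex.exp (((∑ i, ((y i).valMinAbs : ℝ) * (WithLp.toLp 2 ![p.1, p.2] : Momentum) i : ℝ) : ℂ) * Complex.I))‖ ≤ ‖C y‖ * T := by
    intro y
    have h := norm_sliceTransform_sub_tubeFourier_le (L := L) μ K hf hfsupp hM hD y
    rw [← hT] at h
    rw [show C y * (((L : ℂ) ^ 2)⁻¹ * ∑ q : TorusSite 2 L, f (frameLevel μ K (WithLp.toLp 2 (latticeMomentum L q))) * torusChar q y) -
          ((2 * π) ^ 2)⁻¹ • (C y * ∫ p in tube, f (frameLevel μ K (WithLp.toLp 2 ![p.1, p.2])) *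
            Complex.exp (((∑ i, ((y i).valMinAbs : ℝ) * (WithLp.toLp 2 ![p.1, p.2] : Momentum) i : ℝ) : ℂ) * Complex.I)) =
        C y * ((((L : ℂ) ^ 2)⁻¹ * ∑ q : TorusSite 2 L, f (frameLevel μ K (WithLp.toLp 2 (latticeMomentum L q))) * torusChar q y) -
          ((2 * π) ^ 2)⁻¹ • ∫ p in tube, f (frameLevel μ K (WithLp.toLp 2 ![p.1, p.2])) *
            Complex.exp (((∑ i, ((y i).valMinAbs : ℝ) * (WithLp.toLp 2 ![p.1, p.2] : Momentum) i : ℝ) : ℂ) * Complex.I)) by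
      rw [mul_sub, Complex.real_smul, Complex.real_smul]; ring, norm_mul]
    exact mul_le_mul_of_nonneg_left h (norm_nonneg _)
  refine (norm_sum_le _ _).trans ?_
  rw [Finset.sum_mul]
  exact Finset.sum_le_sum fun y _ => hy y

end Summit.HubbardSuperconductivity.HubbardSuperconductivity.Theorems.C4a

end
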